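import Summits.FinalStateConjecture.FinalStateConjecture.Theorems.BartnikGapSettlingBondiBartnikRigidityMarchingLemmaKiteStep
import Summits.FinalStateConjecture.FinalStateConjecture.Theorems.BartnikGapSettlingBondiBartnikRigidityMarchingLemmaChartGlueOff
import Summits.FinalStateConjecture.FinalStateConjecture.Theorems.BartnikGapSettlingBondiBartnikRigidityMarchingLemmaBoundaryContinuity
import Summits.FinalStateConjecture.FinalStateConjecture.Theorems.BartnikGapSettlingBondiBartnikRigidityMarchingLemmaCovering
import Summits.FinalStateConjecture.FinalStateConjecture.Theorems.BartnikGapSettlingBondiBartnikRigidityMarchingLemmaCollarSetPast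
import Summits.FinalStateConjecture.FinalStateConjecture.Theorems.BartnikGapSettlingBondiBartnikRigidityMarchingLemmaSlabPastGeometry
import Summits.FinalStateConjecture.FinalStateConjecture.Theorems.BartnikGapSettlingBondiBartnikRigidityMarchingLemmaReduction
import HarnessLib

/-!
# K2b-5 `stub_marchingLemma`, brick 22: one marching step `Inv τ → Inv (τ + h/2)` — line
# `direct-method-on-the-cone` (crux `BondiBartnikRigidity`, stmt-FinalStateConjecture-10807)

`march_step`: the step of the marching (report K2b-a2 §4) for the invariant `Inv` of
`Marching.marchingLemma_of_step` (domain `Q_τ = (W ∩ {t* < τ}) ∪ F`, `F` the collar set), under the march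
data prepared once from `T₀` (the boundary collar chart `Ψ_E` on `E = Δ½ ∪ (O ∩ W)`, the collar set `F`
by its membership predicate, the numerical constants).  Steps: (C) `K2Route.ExactChartPastSet` for `Q_τ`
(past-closed in closed form: `PastK`, `CollarK.collarSet_pastClosed`; boundary continuity: brick 20); the
kite piece (brick 21); gluing (brick 11b); covering of `W ∩ {t* < τ + h/2}` by `Q_τ ∪ K ∪ F` (brick 16 +
the near-roof property of `F`); restriction to the new domain.

References: Dafermos–Rodnianski arXiv:0811.0354, §5.1 [DafermosRodnianski2008]; Hawking–Ellis 1973, §6.5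
[HawkingEllis1973CUP].  No definitions, no named facts.
-/

noncomputable section

-- D-0017: single-problem summit, `Summit.<S>.<S>.…` by design (cf. lakefile `weak.linter.dupNamespace`).
set_option linter.dupNamespace false
set_option maxSynthPendingDepth 3

open Set Filter Function Topology TopologicalSpace Bundle Metric
open Literature.Geometry.Lorentzian
open scoped Manifold ContDiff Topology ENNReal

namespace Summit.FinalStateConjecture.FinalStateConjecture.Theorems.BondiBartnikRigidity.DirectMethod

namespace StepK

open ChartData (lab_mem_pullK_iff)
open FutureK (translate_mem_region)
open K2Route (JKpast)

variable {X : Type} [TopologicalSpace X] [ChartedSpace E3 X] [IsManifold (𝓡 3) ∞ X]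
  [T2Space X] [SecondCountableTopology X] [ConnectedSpace X] {D : InitialDataSet (𝓡 3) X}

set_option maxHeartbeats 3200000 in
/-- **One marching step** (see the module docstring). [cite: DafermosRodnianski2008, §5.1] -/
theorem march_step (hcbg : choquetBruhat_geroch_exists_mghd_cauchy) (hglue : K2Route.ExactChartGluing)
    (hPast : K2Route.ExactChartPastSet)
    [Kerr.Facts] (𝒱 : VacuumCauchyDevelopment D) (hmax : 𝒱.IsMaximal)
    {M a : ℝ} (hM : 0 < M) (ha : |a| < M) {mo : lorentzGroup × E4} {B : ModelBackground}
    (hB : B = starBackground mo.1 mo.2 M a (fun x => Kerr.radius a (poincareInv mo.1 mo.2 x)))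
    {lab : Kerr.region a M → B.domain} (hlab : ∀ z, (lab z : E4) = (mo.1 : E4 ≃L[ℝ] E4) z.1 + mo.2)
    (hcyl : {y : Kerr.region a M | 0 ≤ y.1 0 ∧ Kerr.radius a y.1 ≤ 3 * M} ⊆ JK M a hM (slabK M a))
    (hfr : frontier (JK M a hM (slabK M a)) ⊆ slabK M a ∪ JK M a hM (outerSphereK M a))
    -- the datum side
    {C : Set 𝒱.carrier} {Φ₀ : B.domain → 𝒱.carrier}
    (hCslab : Φ₀ '' pullK mo M a B (slabK M a) ⊆ C) (hCX : C ⊆ range 𝒱.embed)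
    -- the march data: constants, collar set, boundary collar chart
    {h η w₀ ρ T₁ : ℝ} (hh : 0 < h) (hhM : 4 * h < M) (hT₁w : T₁ ≤ w₀) (hρ₂ : 3 * M + 3 * w₀ ≤ ρ)
    {F O : Set (Kerr.region a M)}
    (hF : ∀ x : Kerr.region a M, x ∈ F ↔ x ∈ interior (JK M a hM (slabK M a)) ∧
      x.1 0 + 2 / 3 * Kerr.radius a x.1 < w₀ ∧ ∃ s, 0 < s ∧ s < η ∧
        (⟨x.1 + (-s) • E4.basisVector 0, translate_mem_region x (-s)⟩ : Kerr.region a M) ∉ JK M a hM (slabK M a))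
    {E' : Set (Kerr.region a M)} (hFE : F ⊆ E') (hroofO : roofK M a hM ∩ {y | Kerr.radius a y.1 ≤ ρ} ⊆ E')
    (hslabE' : slabK M a ⊆ E')
    {ΨE : B.domain → 𝒱.carrier} (hcontE : ContinuousOn ΨE (pullK mo M a B E'))
    (hslabE : ∀ x ∈ pullK mo M a B (slabK M a), ΨE x = Φ₀ x)
    (hroofE : ΨE '' pullK mo M a B (roofK M a hM ∩ {y | Kerr.radius a y.1 ≤ ρ}) ⊆
      frontier (𝒱.metric.causalFuture 𝒱.timeOrientation C))
    (hnearF : ∀ x ∈ interior (JK M a hM (slabK M a)), x.1 0 < T₁ →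
      (∃ z ∈ frontier (JK M a hM (slabK M a)), 0 ≤ z.1 0 ∧ z.1 0 ≤ w₀ ∧ 3 * M ≤ Kerr.radius a z.1 ∧
        Kerr.radius a z.1 ≤ ρ ∧ dist x z ≤ 2 * h) → x ∈ F)
    (hlocF : ∀ y ∈ slabK M a ∪ roofK M a hM ∩ {y | Kerr.radius a y.1 ≤ ρ}, ∃ Nb ∈ 𝓝 y,
      ∀ x ∈ Nb, x ∈ interior (JK M a hM (slabK M a)) → x.1 0 < T₁ → x ∈ F)
    -- the level
    {τ : ℝ} (hτ : 2 * h ≤ τ) (hτT : τ + h ≤ T₁)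
    -- `Inv τ`
    {Ψ : B.domain → 𝒱.carrier}
    (hs : ContMDiffOn 𝓘(ℝ, E4) (𝓡 4) ∞ Ψ (pullK mo M a B (interior (JK M a hM (slabK M a)) ∩ {y | y.1 0 < τ} ∪ F)))
    (he : IsOpenEmbedding ((pullK mo M a B (interior (JK M a hM (slabK M a)) ∩ {y | y.1 0 < τ} ∪ F)).restrict Ψ))
    (himg : Ψ '' pullK mo M a B (interior (JK M a hM (slabK M a)) ∩ {y | y.1 0 < τ} ∪ F) ⊆
      𝒱.metric.causalFuture 𝒱.timeOrientation C)
    (hd : supCkENorm (Subtype.val '' pullK mo M a B (interior (JK M a hM (slabK M a)) ∩ {y | y.1 0 < τ} ∪ F)) 0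
      (𝒱.toSpacetime.deviationExtend B Ψ) ≤ 0)
    (htop : ∀ x ∈ pullK mo M a B (interior (JK M a hM (slabK M a)) ∩ {y | y.1 0 < τ} ∪ F),
      𝒱.timeOrientation.IsFutureDirected
        (mfderiv 𝓘(ℝ, E4) (𝓡 4) Ψ x ((mo.1 : E4 ≃L[ℝ] E4) (Kerr.timeVector M a (poincareInv mo.1 mo.2 x.1)))))
    (hbdry : ∀ x ∈ pullK mo M a B (F ∪ slabK M a ∪ (O ∩ roofK M a hM)), Ψ x = ΨE x)
    (hOρ : roofK M a hM ∩ {y | Kerr.radius a y.1 ≤ ρ} ⊆ O) :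
    ∃ Ψn : B.domain → 𝒱.carrier,
      ContMDiffOn 𝓘(ℝ, E4) (𝓡 4) ∞ Ψn (pullK mo M a B (interior (JK M a hM (slabK M a)) ∩ {y | y.1 0 < τ + h / 2} ∪ F)) ∧
      IsOpenEmbedding ((pullK mo M a B (interior (JK M a hM (slabK M a)) ∩ {y | y.1 0 < τ + h / 2} ∪ F)).restrict Ψn) ∧
      Ψn '' pullK mo M a B (interior (JK M a hM (slabK M a)) ∩ {y | y.1 0 < τ + h / 2} ∪ F) ⊆
        𝒱.metric.causalFuture 𝒱.timeOrientation C ∧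
      supCkENorm (Subtype.val '' pullK mo M a B (interior (JK M a hM (slabK M a)) ∩ {y | y.1 0 < τ + h / 2} ∪ F)) 0
        (𝒱.toSpacetime.deviationExtend B Ψn) ≤ 0 ∧
      (∀ x ∈ pullK mo M a B (interior (JK M a hM (slabK M a)) ∩ {y | y.1 0 < τ + h / 2} ∪ F),
        𝒱.timeOrientation.IsFutureDirected
          (mfderiv 𝓘(ℝ, E4) (𝓡 4) Ψn x ((mo.1 : E4 ≃L[ℝ] E4) (Kerr.timeVector M a (poincareInv mo.1 mo.2 x.1))))) ∧
      (∀ x ∈ pullK mo M a B (F ∪ slabK M a ∪ (O ∩ roofK M a hM)), Ψn x = ΨE x) := by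
  classical
  have hn1 : (1 : ℕ∞ω) ≤ (∞ : ℕ∞ω) := by exact_mod_cast le_top
  set W := interior (JK M a hM (slabK M a)) with hWdef
  set Q : Set (Kerr.region a M) := W ∩ {y | y.1 0 < τ} ∪ F with hQdef
  set roofP : Set (Kerr.region a M) := roofK M a hM ∩ {y | Kerr.radius a y.1 ≤ ρ} with hroofP
  have hJc := FutureK.isClosed_JK_slabK hM hfr
  have hFo : IsOpen F := CollarK.isOpen_collarSet hM hfr hF
  have hFW : F ⊆ W := fun x hx => ((hF x).1 hx).1
  have hQo : IsOpen Q := (K2Route.isOpen_interior_JK_inter_lt M a hM τ).union hFo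
  have hQW : Q ⊆ W := union_subset inter_subset_left hFW
  have hFQ : F ⊆ Q := subset_union_right
  have hQlow : W ∩ {y | y.1 0 < τ} ⊆ Q := subset_union_left
  have hQF : Q ⊆ {y | y.1 0 < τ} ∪ F := union_subset_union_left _ inter_subset_right
  have hW0 : ∀ x ∈ W, 0 < x.1 0 := fun x hx => FutureK.interior_JK_slabK_pos hM ha hx
  have hWr : ∀ x ∈ W, 2 * Kerr.radius a x.1 ≤ 6 * M + 3 * x.1 0 := fun x hx =>
    (FrontierK.JK_slabK_subset hM ha (interior_subset hx)).2
  have hQt : ∀ x ∈ Q, x.1 0 < w₀ := by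
    rintro x (⟨-, hxt⟩ | hxF)
    · exact lt_of_lt_of_le hxt (by linarith)
    · have := ((hF x).1 hxF).2.1; nlinarith [Kerr.radius_nonneg a x.1]
  /- ### (C) the image of `Ψ` is past-closed in `I⁺(C)` -/
  have hQpc : ∀ x ∈ Q, closure (JKpast M a hM {x}) ∩ W ⊆ Q := by
    rintro x (⟨-, hxt⟩ | hxF)
    · exact (PastK.closure_JKpast_inter_subset_lt hM ha hxt W).trans (fun y hy => Or.inl hy)
    · exact (CollarK.collarSet_pastClosed hM ha hcyl hfr hF hxF).trans hFQ
  have hQfr : ∀ x ∈ Q, closure (JKpast M a hM {x}) ∩ frontier (JK M a hM (slabK M a)) ⊆ slabK M a ∪ roofP := fun x hx =>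
    PastK.closure_JKpast_inter_frontier_subset hM ha hfr x (by nlinarith [hWr x (hQW hx), hQt x hx, hW0 x (hQW hx)])
  have hQcpt : ∀ x ∈ Q, IsCompact (closure (JKpast M a hM {x}) ∩ closure (JK M a hM (slabK M a))) := fun x _ =>
    PastK.isCompact_closure_JKpast_inter hM ha x
  -- boundary behaviour of `Ψ`
  have hbdry' : ∀ x ∈ pullK mo M a B (F ∪ (slabK M a ∪ roofP)), Ψ x = ΨE x := by
    rintro x ⟨hreg, hx⟩
    refine hbdry x ⟨hreg, ?_⟩
    rcases hx with hxF | hxS | hxR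
    · exact Or.inl (Or.inl hxF)
    · exact Or.inl (Or.inr hxS)
    · exact Or.inr ⟨hOρ hxR, hxR.1⟩
  have hcontQ : ContinuousOn Ψ (pullK mo M a B (Q ∪ slabK M a ∪ roofP)) := by
    rw [union_assoc]
    refine BoundaryK.continuousOn_union_boundary hB hQo hFE (union_subset hslabE' hroofO) hs hcontE hbdry' ?_
    intro y hy
    obtain ⟨Nb, hNb, hNbF⟩ := hlocF y hy
    refine ⟨Nb, hNb, ?_⟩
    rintro x ⟨hxN, hxQ⟩
    rcases hxQ with ⟨hxW, hxt⟩ | hxF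
    · exact hNbF x hxN hxW (lt_of_lt_of_le hxt (by linarith))
    · exact hxF
  have hslabΨ : ∀ x ∈ pullK mo M a B (slabK M a), Ψ x = Φ₀ x := fun x hx => by
    rw [hbdry' x ⟨hx.1, Or.inr (Or.inl hx.2)⟩]; exact hslabE x hx
  have hroofΨ : Ψ '' pullK mo M a B roofP ⊆ frontier (𝒱.metric.causalFuture 𝒱.timeOrientation C) := by
    rintro _ ⟨x, hx, rfl⟩
    rw [hbdry' x ⟨hx.1, Or.inr (Or.inr hx.2)⟩]; exact hroofE ⟨x, hx, rfl⟩
  have hpast := hPast X D 𝒱 M a hM mo B Φ₀ Ψ C Q ρ ha hB hCslab hCX hQo hQW hQpc hQfr hQcpt hs he himg hd htop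
    hcontQ hslabΨ hroofΨ
  have hQI : Ψ '' pullK mo M a B Q ⊆ 𝒱.metric.chronologicalFuture 𝒱.timeOrientation C := by
    have := ChartCausal.image_subset_chronologicalFuture (𝒮 := 𝒱.toSpacetime) hM hlab hQo hB hs hd htop himg
    rwa [LorentzianMetric.chronologicalFuture_causalFuture_eq_of_boundaryless hn1] at this
  /- ### the kite piece -/
  have hFvert : ∀ z ∈ F, ∀ u : ℝ, 0 ≤ u →
      (⟨z.1 + (-u) • E4.basisVector 0, translate_mem_region z (-u)⟩ : Kerr.region a M) ∈ W →
      (⟨z.1 + (-u) • E4.basisVector 0, translate_mem_region z (-u)⟩ : Kerr.region a M) ∈ F :=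
    fun z hz u hu hW => CollarK.collarSet_vertical hM hcyl hF hz hu hW
  obtain ⟨U, Ψ', hUo, hUW, hcrit, hs', he', himg', hd', htop', hagree, hcross, hoff⟩ :=
    kite_step hcbg hglue 𝒱 hmax hM ha hB hlab hcyl hfr hQo hFo hFQ hh hτ hQlow hQF hFvert hs he himg hd htop hpast hQI
  /- ### gluing -/
  obtain ⟨Ψn, hsn, hen, hdn, htopn, hnQ, hnU, hnoff⟩ := ChartGlue.glue' (𝒮 := 𝒱.toSpacetime) hB hQo hUo hs he hd htop
    hs' he' hd' htop' hagree hcross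
  have himgn : Ψn '' pullK mo M a B (Q ∪ U) ⊆ 𝒱.metric.causalFuture 𝒱.timeOrientation C := by
    rintro _ ⟨x, ⟨hreg, hx⟩, rfl⟩
    by_cases hxQ : x ∈ pullK mo M a B Q
    · rw [hnQ x hxQ]; exact himg ⟨x, hxQ, rfl⟩
    · have hxU : x ∈ pullK mo M a B U := ⟨hreg, hx.resolve_left (fun h' => hxQ ⟨hreg, h'⟩)⟩
      rw [hnU x hxU]; exact himg' ⟨x, hxU, rfl⟩
  /- ### covering of the new domain -/
  set Q' : Set (Kerr.region a M) := W ∩ {y | y.1 0 < τ + h / 2} ∪ F with hQ'def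
  have hQ'o : IsOpen Q' := (K2Route.isOpen_interior_JK_inter_lt M a hM (τ + h / 2)).union hFo
  have hcov : Q' ⊆ Q ∪ U := by
    rintro x (⟨hxW, hxt⟩ | hxF)
    swap
    · exact Or.inl (hFQ hxF)
    by_cases hxτ : x.1 0 < τ
    · exact Or.inl (Or.inl ⟨hxW, hxτ⟩)
    push Not at hxτ
    have hxt' : x.1 0 < τ + h / 2 := hxt
    by_cases hcone : ∀ z : E3, ‖z - E4.spatial x.1‖ ≤ x.1 0 - (τ - h / 2) →
        min (Kerr.radius a x.1) (Kerr.rPlus M a) ≤ Kerr.radius a (E4.ofTimeSpace 0 z) →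
        ∃ hz : E4.ofTimeSpace (τ - h / 2) z ∈ Kerr.region a M,
          (⟨E4.ofTimeSpace (τ - h / 2) z, hz⟩ : Kerr.region a M) ∈ W
    · exact Or.inr (hcrit x hxW (by linarith) hxt' hcone)
    · -- off the kite: near the roof, hence in `F`
      obtain ⟨z, hzfr, hz1, hz2, hz3, hz4, hz5⟩ := CoverK.exists_frontier_near_of_not_upper hM ha hcyl hfr
        (σ := τ - h / 2) (h := h) (by linarith) hh hhM (N := {z : E3 | ∃ hz : E4.ofTimeSpace (τ - h / 2) z ∈ Kerr.region a M,
          (⟨E4.ofTimeSpace (τ - h / 2) z, hz⟩ : Kerr.region a M) ∈ W}) (fun z hz => hz) hxW (by linarith)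
        (by linarith) hcone
      have hxT : x.1 0 < T₁ := by linarith
      refine Or.inl (hFQ (hnearF x hxW hxT ⟨z, hzfr, by linarith, by linarith, hz3, ?_, hz5⟩))
      have := hWr x hxW
      nlinarith
  /- ### `Inv (τ + h/2)` -/
  obtain ⟨hsn', hen', himgn', hdn'⟩ := K2Route.exactOn_pullK_mono hB hsn hen himgn hdn hcov hQ'o
  refine ⟨Ψn, hsn', hen', himgn', hdn', fun x hx => htopn x (pullK_mono _ _ _ _ hcov hx), ?_⟩
  -- boundary clause
  rintro x ⟨hreg, hx⟩
  by_cases hxQ : x ∈ pullK mo M a B Q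
  · rw [hnQ x hxQ]; exact hbdry x ⟨hreg, hx⟩
  · have hxU : x ∉ pullK mo M a B U := by
      rintro ⟨_, hxU⟩
      have hxW : (⟨poincareInv mo.1 mo.2 x.1, hreg⟩ : Kerr.region a M) ∈ W := hUW hxU
      rcases hx with (hxF | hxS) | hxR
      · exact hxQ ⟨hreg, hFQ hxF⟩
      · exact absurd hxS.1 (ne_of_gt (hW0 _ hxW))
      · exact (disjoint_interior_frontier (s := JK M a hM (slabK M a))).le_bot ⟨hxW, hxR.2.1⟩
    rw [hnoff x hxQ, hoff x hxU]
    exact hbdry x ⟨hreg, hx⟩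

end StepK

/-- **Registered bookkeeping sub-goal `stub_marchDomainOpen` of the line** (brick of the landing of K2b-5
`stub_marchingLemma`): the level domains `(W ∩ {t* < τ}) ∪ F` of the marching are open when `F` is
(anchor of this file, whose content is one marching step `StepK.march_step`). [folklore] -/
theorem stub_marchDomainOpen [Kerr.Facts] : ∀ (M a : ℝ) (hM : 0 < M) (τ : ℝ) (F : Set (Kerr.region a M)), IsOpen F →
    IsOpen (interior (JK M a hM (slabK M a)) ∩ {y | y.1 0 < τ} ∪ F) :=
  fun M a hM τ _ hF => (K2Route.isOpen_interior_JK_inter_lt M a hM τ).union hF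

end Summit.FinalStateConjecture.FinalStateConjecture.Theorems.BondiBartnikRigidity.DirectMethod

end
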